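import Mathlib

/-!
# AWS axiom system — integrality is free: the greedy rational construction (abstract part)

HONEST LABEL (verbatim on every AWS file).  One-way implication from a strengthened,
prime-side-only axiom system; the existence of such an object is NOT claimed and is the located
gap; the converse (RH ⇒ existence) is out of scope and, for this axiom system, tautological
rather than informative (AXIOM-CONTENT.md §2; `riemannHypothesis_iff_exists_tautologicalCarrier`).
Framing: lottery ticket at the motivic door; RH probability
negligible; consolation prizes are real: a new semi-local Weil-positivity theorem, or a located gap
in the Connes–Consani programme, plus the ff-door theorem.

## Content (pure linear algebra over `ℝ`; no zeta, no Weil functional)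

This is the abstract engine behind `MotivicDoorAWSIntegralCarrier`: INTEGRALITY of all the
prime-side data of a generating family can be arranged RH-free, so "the pairing is `ℤ`-valued on an
integral lattice" is NOT an axiom that separates a geometric object from the tautological carrier
(AXIOM-CONTENT.md §3 lists integrality as a candidate; this file and its sequel settle it).

Setting: a real vector space `V` (coefficient space of a family of test functions), a symmetric
bilinear form `B` (polarised `Re W(u ⋆ ṽ)`), finitely many linear functionals `L i` (the two
masses), a subspace `V₀` (combinations of auxiliary bumps in a small window) on which
`B x x > 0` for `x ≠ 0` and which is not finite-dimensional, targets `u k` (an enumeration of a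
countable `C¹`-dense set) and "algebraically open" neighbourhoods `N k` of the targets.

* `IntegralGreedy.exists_rat_eq_quadratic` — a quadratic `α + 2βs + γs²`, `γ > 0`, takes a rational
  value at some point of every open interval (IVT + density of `ℚ`).
* `IntegralGreedy.greedy_step` — ONE STEP: given functionals `L i`, `Λ j` jointly surjective on
  `V₀`, a target `u` and an algebraically open `N ∋ u`, there is `φ ∈ N`, `φ - u ∈ V₀`, with ALL of
  `L i φ`, `Λ j φ`, `B φ φ` RATIONAL and `(L, Λ, B φ ·)` still jointly surjective on `V₀`
  (dual family; a fresh direction `θ ∈ V₀ ∩ ⋂ ker` with `B θ θ > 0`; move along `θ` to make the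
  self-pairing rational; of two candidate parameters at most one can kill surjectivity).
* `IntegralGreedy.exists_rational_sequence` — the recursion: `φ k ∈ N k`, `φ k - u k ∈ V₀`,
  `L i (φ k) ∈ ℚ`, `B (φ j) (φ k) ∈ ℚ` for all `i, j, k`.
* `IntegralGreedy.exists_nat_rescaling`, `IntegralGreedy.exists_integral_sequence` — clearing
  denominators along `ℕ` by positive integers `M k`: `M k • φ k` has INTEGER data.
-/

noncomputable section

open Set

namespace Summit.RiemannHypothesis.RiemannHypothesis.Theorems.MotivicDoor.AWS

-- the mandated namespace repeats a component (single-conjunct summit)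
set_option linter.dupNamespace false

namespace IntegralGreedy

variable {V : Type*} [AddCommGroup V] [Module ℝ V]

/-! ## A quadratic takes rational values in every interval -/

/-- A quadratic polynomial `α + 2βs + γs²` with `γ > 0` takes a rational value at some point of
every nonempty open interval `(lo, hi)`. -/
theorem exists_rat_eq_quadratic (α β : ℝ) {γ lo hi : ℝ} (hγ : 0 < γ) (hlt : lo < hi) :
    ∃ s, lo < s ∧ s < hi ∧ ∃ q : ℚ, α + 2 * β * s + γ * s ^ 2 = q := by
  set g : ℝ → ℝ := fun s ↦ α + 2 * β * s + γ * s ^ 2 with hg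
  have hcont : Continuous g := by
    simp only [hg]
    fun_prop
  -- two points of the interval with different values
  obtain ⟨u, v, hu, huv, hv, hne⟩ : ∃ u v, lo < u ∧ u < v ∧ v < hi ∧ g u ≠ g v := by
    by_cases h12 : g (lo + (hi - lo) / 4) ≠ g (lo + (hi - lo) / 2)
    · exact ⟨_, _, by linarith, by linarith, by linarith, h12⟩
    by_cases h13 : g (lo + (hi - lo) / 4) ≠ g (lo + 3 * (hi - lo) / 4)
    · exact ⟨_, _, by linarith, by linarith, by linarith, h13⟩
    exfalso
    push Not at h12 h13
    simp only [hg] at h12 h13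
    have hd : 0 < hi - lo := sub_pos.mpr hlt
    have key : γ * (hi - lo) ^ 2 = 0 := by linear_combination 16 * h12 - 8 * h13
    rcases mul_eq_zero.mp key with h | h
    · exact hγ.ne' h
    · exact hd.ne' (by simpa using pow_eq_zero_iff (n := 2) (by norm_num) |>.mp h)
  -- a rational strictly between the two values, attained by the intermediate value theorem
  rcases lt_or_gt_of_ne hne with hlt' | hgt'
  · obtain ⟨q, hq1, hq2⟩ := exists_rat_btwn hlt'
    obtain ⟨s, hs, hsq⟩ := intermediate_value_Icc huv.le hcont.continuousOn ⟨hq1.le, hq2.le⟩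
    exact ⟨s, by linarith [hs.1], by linarith [hs.2], q, hsq⟩
  · obtain ⟨q, hq1, hq2⟩ := exists_rat_btwn hgt'
    obtain ⟨s, hs, hsq⟩ := intermediate_value_Icc' huv.le hcont.continuousOn ⟨hq1.le, hq2.le⟩
    exact ⟨s, by linarith [hs.1], by linarith [hs.2], q, hsq⟩

/-! ## One step of the greedy construction -/

/-- **One greedy step.**  Data: a subspace `V₀` on which `B x x > 0` for `x ≠ 0` and which is not
spanned by any finite set; functionals `L i` (`i : Fin p`) and `Λ j` (`j : ι`) that are jointly
surjective on `V₀`; a target `u` and a set `N` algebraically open at `u` along `V₀`.  Conclusion: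
some `φ ∈ N` with `φ - u ∈ V₀` has all of `L i φ`, `Λ j φ`, `B φ φ` rational, and
`(L, Λ, B φ ·)` is again jointly surjective on `V₀`. -/
theorem greedy_step {p : ℕ} {ι : Type} [Fintype ι]
    (V₀ : Submodule ℝ V) (B : V →ₗ[ℝ] V →ₗ[ℝ] ℝ) (hB : ∀ x y, B x y = B y x)
    (hpos : ∀ x ∈ V₀, x ≠ 0 → 0 < B x x)
    (hbig : ∀ s : Finset V, ∃ w ∈ V₀, w ∉ Submodule.span ℝ (s : Set V))
    (L : Fin p → V →ₗ[ℝ] ℝ) (Λ : ι → V →ₗ[ℝ] ℝ)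
    (hsurj : ∀ (y : Fin p → ℝ) (y' : ι → ℝ), ∃ x ∈ V₀, (∀ i, L i x = y i) ∧ ∀ j, Λ j x = y' j)
    (u : V) (N : Set V)
    (hN : ∀ (κ : Type) [Fintype κ] (F : κ → V), (∀ a, F a ∈ V₀) →
      ∃ δ : ℝ, 0 < δ ∧ ∀ t : κ → ℝ, (∀ a, |t a| ≤ δ) → u + ∑ a, t a • F a ∈ N) :
    ∃ φ : V, φ - u ∈ V₀ ∧ φ ∈ N ∧ (∀ i, ∃ q : ℚ, L i φ = q) ∧ (∀ j, ∃ q : ℚ, Λ j φ = q) ∧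
      (∃ q : ℚ, B φ φ = q) ∧
      ∀ (y : Fin p → ℝ) (y' : ι → ℝ) (r : ℝ),
        ∃ x ∈ V₀, (∀ i, L i x = y i) ∧ (∀ j, Λ j x = y' j) ∧ B φ x = r := by
  classical
  /- 1. dual families `η i`, `η' j` in `V₀` -/
  have hη : ∀ i : Fin p, ∃ x ∈ V₀, (∀ i', L i' x = if i' = i then 1 else 0) ∧ ∀ j, Λ j x = 0 :=
    fun i ↦ hsurj (fun i' ↦ if i' = i then 1 else 0) 0
  have hη' : ∀ j : ι, ∃ x ∈ V₀, (∀ i, L i x = 0) ∧ ∀ j', Λ j' x = if j' = j then 1 else 0 :=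
    fun j ↦ hsurj 0 (fun j' ↦ if j' = j then 1 else 0)
  choose η hηV hηL hηΛ using hη
  choose η' hη'V hη'L hη'Λ using hη'
  /- 2. a fresh direction `θ ∈ V₀ ∩ ⋂ ker`, `θ ≠ 0`, hence `B θ θ > 0` -/
  obtain ⟨w, hwV, hw⟩ := hbig (Finset.univ.image η ∪ Finset.univ.image η')
  set θ : V := w - ∑ i, L i w • η i - ∑ j, Λ j w • η' j with hθ_def
  have hθV : θ ∈ V₀ :=
    V₀.sub_mem (V₀.sub_mem hwV (V₀.sum_mem fun i _ ↦ V₀.smul_mem _ (hηV i)))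
      (V₀.sum_mem fun j _ ↦ V₀.smul_mem _ (hη'V j))
  have hθL : ∀ i, L i θ = 0 := fun i ↦ by
    simp only [hθ_def, map_sub, map_sum, map_smul, smul_eq_mul, hηL, hη'L, mul_ite, mul_one,
      mul_zero, Finset.sum_ite_eq, Finset.mem_univ, if_true, Finset.sum_const_zero]
    ring
  have hθΛ : ∀ j, Λ j θ = 0 := fun j ↦ by
    simp only [hθ_def, map_sub, map_sum, map_smul, smul_eq_mul, hηΛ, hη'Λ, mul_ite, mul_one,
      mul_zero, Finset.sum_ite_eq, Finset.mem_univ, if_true, Finset.sum_const_zero]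
    ring
  have hθne : θ ≠ 0 := by
    intro h
    apply hw
    have hw_eq : w = ∑ i, L i w • η i + ∑ j, Λ j w • η' j := by
      rw [← sub_eq_zero, ← h, hθ_def]; abel
    rw [hw_eq]
    refine Submodule.add_mem _ (Submodule.sum_mem _ fun i _ ↦ Submodule.smul_mem _ _
      (Submodule.subset_span ?_)) (Submodule.sum_mem _ fun j _ ↦ Submodule.smul_mem _ _
      (Submodule.subset_span ?_))
    · simp
    · simp
  have hQθ : 0 < B θ θ := hpos θ hθV hθne
  /- 3. the tolerance of `N` for the finite family `(η, η', w)` -/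
  obtain ⟨δ, hδ, hδN⟩ := hN ((Fin p ⊕ ι) ⊕ Unit) (Sum.elim (Sum.elim η η') fun _ ↦ w) (by
    rintro ((i | j) | ⟨⟩)
    · exact hηV i
    · exact hη'V j
    · exact hwV)
  set Mw : ℝ := 1 + ∑ i, |L i w| + ∑ j, |Λ j w| with hMw_def
  have hsum1 : 0 ≤ ∑ i, |L i w| := Finset.sum_nonneg fun i _ ↦ abs_nonneg _
  have hsum2 : 0 ≤ ∑ j, |Λ j w| := Finset.sum_nonneg fun j _ ↦ abs_nonneg _
  have hMw : 0 < Mw := by positivity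
  have hLw : ∀ i, |L i w| ≤ Mw := fun i ↦ by
    have := Finset.single_le_sum (fun i _ ↦ abs_nonneg (L i w)) (Finset.mem_univ i)
    linarith
  have hΛw : ∀ j, |Λ j w| ≤ Mw := fun j ↦ by
    have := Finset.single_le_sum (fun j _ ↦ abs_nonneg (Λ j w)) (Finset.mem_univ j)
    linarith
  set δ₂ : ℝ := δ / (2 * Mw) with hδ₂_def
  have hδ₂ : 0 < δ₂ := by positivity
  have hδ₂M : δ₂ * Mw = δ / 2 := by rw [hδ₂_def]; field_simp
  /- 4. rational targets for the functionals, `δ/2`-close to their values at `u` -/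
  have hrat : ∀ x : ℝ, ∃ q : ℚ, |(q : ℝ) - x| ≤ δ / 2 := fun x ↦ by
    obtain ⟨q, h1, h2⟩ := exists_rat_btwn (show x - δ / 2 < x + δ / 2 by linarith)
    exact ⟨q, abs_le.mpr ⟨by linarith, by linarith⟩⟩
  choose q hq using fun i ↦ hrat (L i u)
  choose q' hq' using fun j ↦ hrat (Λ j u)
  set ψ₀ : V := u + ∑ i, ((q i : ℝ) - L i u) • η i + ∑ j, ((q' j : ℝ) - Λ j u) • η' j with hψ₀_def
  have hψL : ∀ i, L i ψ₀ = q i := fun i ↦ by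
    simp only [hψ₀_def, map_add, map_sum, map_smul, smul_eq_mul, hηL, hη'L, mul_ite, mul_one,
      mul_zero, Finset.sum_ite_eq, Finset.mem_univ, if_true, Finset.sum_const_zero]
    ring
  have hψΛ : ∀ j, Λ j ψ₀ = q' j := fun j ↦ by
    simp only [hψ₀_def, map_add, map_sum, map_smul, smul_eq_mul, hηΛ, hη'Λ, mul_ite, mul_one,
      mul_zero, Finset.sum_ite_eq, Finset.mem_univ, if_true, Finset.sum_const_zero]
    ring
  /- 5. the self-pairing along `θ` is a genuine quadratic; two rational parameters -/
  have hquad : ∀ s : ℝ, B (ψ₀ + s • θ) (ψ₀ + s • θ) =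
      B ψ₀ ψ₀ + 2 * B ψ₀ θ * s + B θ θ * s ^ 2 := fun s ↦ by
    simp only [map_add, map_smul, LinearMap.add_apply, LinearMap.smul_apply, smul_eq_mul]
    rw [hB θ ψ₀]
    ring
  have hlin : ∀ s : ℝ, B (ψ₀ + s • θ) θ = B ψ₀ θ + s * B θ θ := fun s ↦ by
    simp only [map_add, map_smul, LinearMap.add_apply, LinearMap.smul_apply, smul_eq_mul]
  obtain ⟨s₁, hs₁0, hs₁1, r₁, hr₁⟩ :=
    exists_rat_eq_quadratic (B ψ₀ ψ₀) (B ψ₀ θ) hQθ (show (0 : ℝ) < δ₂ / 2 by positivity)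
  obtain ⟨s₂, hs₂0, hs₂1, r₂, hr₂⟩ :=
    exists_rat_eq_quadratic (B ψ₀ ψ₀) (B ψ₀ θ) hQθ (show δ₂ / 2 < δ₂ by linarith)
  /- 6. at most one of them kills joint surjectivity -/
  have key : ∃ s : ℝ, 0 < s ∧ s < δ₂ ∧ (∃ r : ℚ, B (ψ₀ + s • θ) (ψ₀ + s • θ) = r) ∧
      ∃ z ∈ V₀, (∀ i, L i z = 0) ∧ (∀ j, Λ j z = 0) ∧ B (ψ₀ + s • θ) z ≠ 0 := by
    by_contra hcon
    push Not at hcon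
    have h1 := hcon s₁ hs₁0 (by linarith) ⟨r₁, by rw [hquad]; exact hr₁⟩ θ hθV hθL hθΛ
    have h2 := hcon s₂ (by linarith) hs₂1 ⟨r₂, by rw [hquad]; exact hr₂⟩ θ hθV hθL hθΛ
    rw [hlin] at h1 h2
    have h12 : (s₁ - s₂) * B θ θ = 0 := by linear_combination h1 - h2
    rcases mul_eq_zero.mp h12 with h | h
    · linarith
    · exact hQθ.ne' h
  obtain ⟨s, hs0, hsδ, ⟨r, hr⟩, z, hzV, hzL, hzΛ, hzB⟩ := key
  refine ⟨ψ₀ + s • θ, ?_, ?_, fun i ↦ ⟨q i, ?_⟩, fun j ↦ ⟨q' j, ?_⟩, ⟨r, hr⟩, ?_⟩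
  · -- `φ - u ∈ V₀`
    have : ψ₀ + s • θ - u =
        (∑ i, ((q i : ℝ) - L i u) • η i + ∑ j, ((q' j : ℝ) - Λ j u) • η' j) + s • θ := by
      rw [hψ₀_def]; abel
    rw [this]
    exact V₀.add_mem (V₀.add_mem (V₀.sum_mem fun i _ ↦ V₀.smul_mem _ (hηV i))
      (V₀.sum_mem fun j _ ↦ V₀.smul_mem _ (hη'V j))) (V₀.smul_mem _ hθV)
  · -- `φ ∈ N`: write `φ = u + Σ t_a F_a` with small coefficients
    set t : (Fin p ⊕ ι) ⊕ Unit → ℝ := Sum.elim (Sum.elim (fun i ↦ (q i : ℝ) - L i u - s * L i w)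
      fun j ↦ (q' j : ℝ) - Λ j u - s * Λ j w) fun _ ↦ s with ht_def
    have hexp : ψ₀ + s • θ = u + ∑ a, t a • (Sum.elim (Sum.elim η η') fun _ ↦ w) a := by
      simp only [Fintype.sum_sum_type, ht_def, Sum.elim_inl, Sum.elim_inr, Finset.univ_unique,
        Finset.sum_singleton, hψ₀_def, hθ_def, smul_sub, Finset.smul_sum, smul_smul, sub_smul,
        Finset.sum_sub_distrib]
      abel
    rw [hexp]
    refine hδN t ?_
    rintro ((i | j) | ⟨⟩)
    · simp only [ht_def, Sum.elim_inl]
      calc |(q i : ℝ) - L i u - s * L i w| ≤ |(q i : ℝ) - L i u| + |s * L i w| := abs_sub _ _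
        _ ≤ δ / 2 + δ₂ * Mw := by
            refine add_le_add (hq i) ?_
            rw [abs_mul, abs_of_pos hs0]
            exact mul_le_mul hsδ.le (hLw i) (abs_nonneg _) hδ₂.le
        _ = δ := by rw [hδ₂M]; ring
    · simp only [ht_def, Sum.elim_inl, Sum.elim_inr]
      calc |(q' j : ℝ) - Λ j u - s * Λ j w| ≤ |(q' j : ℝ) - Λ j u| + |s * Λ j w| := abs_sub _ _
        _ ≤ δ / 2 + δ₂ * Mw := by
            refine add_le_add (hq' j) ?_
            rw [abs_mul, abs_of_pos hs0]
            exact mul_le_mul hsδ.le (hΛw j) (abs_nonneg _) hδ₂.le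
        _ = δ := by rw [hδ₂M]; ring
    · simp only [ht_def, Sum.elim_inr, abs_of_pos hs0]
      calc s ≤ δ₂ := hsδ.le
        _ = δ₂ * 1 := (mul_one _).symm
        _ ≤ δ₂ * Mw := by
            refine mul_le_mul_of_nonneg_left ?_ hδ₂.le
            rw [hMw_def]; linarith
        _ = δ / 2 := hδ₂M
        _ ≤ δ := by linarith
  · rw [map_add, map_smul, hψL, hθL, smul_zero, add_zero]
  · rw [map_add, map_smul, hψΛ, hθΛ, smul_zero, add_zero]
  · -- joint surjectivity of `(L, Λ, B φ ·)` on `V₀`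
    intro y y' r'
    obtain ⟨x₀, hx₀V, hx₀L, hx₀Λ⟩ := hsurj y y'
    refine ⟨x₀ + ((r' - B (ψ₀ + s • θ) x₀) / B (ψ₀ + s • θ) z) • z,
      V₀.add_mem hx₀V (V₀.smul_mem _ hzV), fun i ↦ ?_, fun j ↦ ?_, ?_⟩
    · rw [map_add, map_smul, hx₀L, hzL, smul_zero, add_zero]
    · rw [map_add, map_smul, hx₀Λ, hzΛ, smul_zero, add_zero]
    · rw [map_add, map_smul, smul_eq_mul, div_mul_cancel₀ _ hzB]
      ring

/-! ## The recursion -/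

/-- **The greedy rational sequence.**  With `V₀`, `B`, `L` as in `greedy_step` (the masses `L`
jointly surjective on `V₀`), targets `u k` and sets `N k` algebraically open at `u k` along `V₀`,
there is a sequence `φ k ∈ N k` with `φ k - u k ∈ V₀` all of whose masses `L i (φ k)` and
pairings `B (φ j) (φ k)` (including the self-pairings) are RATIONAL. -/
theorem exists_rational_sequence {p : ℕ}
    (V₀ : Submodule ℝ V) (B : V →ₗ[ℝ] V →ₗ[ℝ] ℝ) (hB : ∀ x y, B x y = B y x)
    (hpos : ∀ x ∈ V₀, x ≠ 0 → 0 < B x x)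
    (hbig : ∀ s : Finset V, ∃ w ∈ V₀, w ∉ Submodule.span ℝ (s : Set V))
    (L : Fin p → V →ₗ[ℝ] ℝ) (hL : ∀ y : Fin p → ℝ, ∃ x ∈ V₀, ∀ i, L i x = y i)
    (u : ℕ → V) (N : ℕ → Set V)
    (hN : ∀ (k : ℕ) (κ : Type) [Fintype κ] (F : κ → V), (∀ a, F a ∈ V₀) →
      ∃ δ : ℝ, 0 < δ ∧ ∀ t : κ → ℝ, (∀ a, |t a| ≤ δ) → u k + ∑ a, t a • F a ∈ N k) :
    ∃ φ : ℕ → V, (∀ k, φ k - u k ∈ V₀) ∧ (∀ k, φ k ∈ N k) ∧ (∀ i k, ∃ q : ℚ, L i (φ k) = q) ∧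
      ∀ j k, ∃ q : ℚ, B (φ j) (φ k) = q := by
  classical
  -- a TOTAL step function: the step lemma under the joint-surjectivity invariant, `0` otherwise
  have hstep : ∀ (k : ℕ) (prev : Fin k → V), ∃ φ : V,
      (∀ (y : Fin p → ℝ) (y' : Fin k → ℝ), ∃ x ∈ V₀, (∀ i, L i x = y i) ∧ ∀ j, B (prev j) x = y' j) →
        φ - u k ∈ V₀ ∧ φ ∈ N k ∧ (∀ i, ∃ q : ℚ, L i φ = q) ∧ (∀ j, ∃ q : ℚ, B (prev j) φ = q) ∧
          (∃ q : ℚ, B φ φ = q) ∧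
          ∀ (y : Fin p → ℝ) (y' : Fin k → ℝ) (r : ℝ),
            ∃ x ∈ V₀, (∀ i, L i x = y i) ∧ (∀ j, B (prev j) x = y' j) ∧ B φ x = r := by
    intro k prev
    by_cases hs : ∀ (y : Fin p → ℝ) (y' : Fin k → ℝ),
        ∃ x ∈ V₀, (∀ i, L i x = y i) ∧ ∀ j, B (prev j) x = y' j
    · obtain ⟨φ, h⟩ := greedy_step V₀ B hB hpos hbig L (fun j ↦ B (prev j)) hs (u k) (N k) (hN k)
      exact ⟨φ, fun _ ↦ h⟩
    · exact ⟨0, fun h ↦ absurd h hs⟩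
  choose sf hsf using hstep
  -- the prefix recursion and the sequence
  let P : ℕ → ℕ → V := fun k ↦
    Nat.rec (fun _ ↦ (0 : V)) (fun k Pk ↦ Function.update Pk k (sf k fun j : Fin k ↦ Pk j)) k
  let φ : ℕ → V := fun k ↦ sf k fun j : Fin k ↦ P k j
  have hP : ∀ k j, j < k → P k j = φ j := by
    intro k
    induction k with
    | zero => intro j hj; omega
    | succ k ih =>
      intro j hj
      change Function.update (P k) k (sf k fun j : Fin k ↦ P k j) j = φ j
      rcases Nat.lt_succ_iff_lt_or_eq.mp hj with hj | rfl
      · rw [Function.update_of_ne (Nat.ne_of_lt hj)]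
        exact ih j hj
      · rw [Function.update_self]
  have hφ : ∀ k, φ k = sf k fun j : Fin k ↦ φ j := fun k ↦ by
    change sf k (fun j : Fin k ↦ P k j) = _
    congr 1
    funext j
    exact hP k j j.isLt
  -- the invariant: `(L, B (φ 0) ·, …, B (φ (k-1)) ·)` jointly surjective on `V₀`
  have hinv : ∀ k, ∀ (y : Fin p → ℝ) (y' : Fin k → ℝ),
      ∃ x ∈ V₀, (∀ i, L i x = y i) ∧ ∀ j : Fin k, B (φ j) x = y' j := by
    intro k
    induction k with
    | zero =>
      intro y y'
      obtain ⟨x, hx, h⟩ := hL y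
      exact ⟨x, hx, h, fun j ↦ j.elim0⟩
    | succ k ih =>
      intro y y'
      have h := (hsf k (fun j : Fin k ↦ φ j) ih).2.2.2.2.2 y (fun j ↦ y' j.castSucc) (y' (Fin.last k))
      rw [← hφ k] at h
      obtain ⟨x, hxV, hxL, hxB, hxk⟩ := h
      refine ⟨x, hxV, hxL, fun j ↦ ?_⟩
      refine Fin.lastCases ?_ (fun i ↦ ?_) j
      · simpa using hxk
      · simpa using hxB i
  have hspec : ∀ k, φ k - u k ∈ V₀ ∧ φ k ∈ N k ∧ (∀ i, ∃ q : ℚ, L i (φ k) = q) ∧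
      (∀ j : Fin k, ∃ q : ℚ, B (φ j) (φ k) = q) ∧ ∃ q : ℚ, B (φ k) (φ k) = q := fun k ↦ by
    have h := hsf k (fun j : Fin k ↦ φ j) (hinv k)
    rw [← hφ k] at h
    exact ⟨h.1, h.2.1, h.2.2.1, h.2.2.2.1, h.2.2.2.2.1⟩
  refine ⟨φ, fun k ↦ (hspec k).1, fun k ↦ (hspec k).2.1, fun i k ↦ (hspec k).2.2.1 i, fun j k ↦ ?_⟩
  rcases lt_trichotomy j k with hjk | rfl | hkj
  · exact (hspec k).2.2.2.1 ⟨j, hjk⟩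
  · exact (hspec _).2.2.2.2
  · obtain ⟨q, hq⟩ := (hspec j).2.2.2.1 ⟨k, hkj⟩
    exact ⟨q, by rw [hB]; exact hq⟩

/-! ## Clearing denominators along `ℕ` -/

/-- A natural number divisible by the denominator of `q` multiplies `q` into `ℤ`. -/
theorem exists_int_of_den_dvd (q : ℚ) {m : ℕ} (h : q.den ∣ m) : ∃ z : ℤ, (m : ℚ) * q = z := by
  obtain ⟨c, rfl⟩ := h
  refine ⟨c * q.num, ?_⟩
  push_cast
  rw [mul_comm (q.den : ℚ) c, mul_assoc, Rat.den_mul_eq_num]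

/-- **Integer rescaling.**  For rational data `a i k` (finitely many per `k`) and `b j k`, there
are positive integers `M k` with `M k * a i k ∈ ℤ` and `M j * M k * b j k ∈ ℤ` for `j ≤ k` — no
recursion: `M k` is the product of the denominators of `a · k` and `b j k`, `j ≤ k`. -/
theorem exists_nat_rescaling {p : ℕ} (a : Fin p → ℕ → ℚ) (b : ℕ → ℕ → ℚ) :
    ∃ M : ℕ → ℕ, (∀ k, 0 < M k) ∧ (∀ i k, ∃ z : ℤ, (M k : ℚ) * a i k = z) ∧
      ∀ j k, j ≤ k → ∃ z : ℤ, (M j : ℚ) * M k * b j k = z := by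
  refine ⟨fun k ↦ (∏ i, (a i k).den) * ∏ j ∈ Finset.range (k + 1), (b j k).den, fun k ↦ ?_,
    fun i k ↦ ?_, fun j k hjk ↦ ?_⟩
  · exact Nat.mul_pos (Finset.prod_pos fun i _ ↦ (a i k).den_pos)
      (Finset.prod_pos fun j _ ↦ (b j k).den_pos)
  · exact exists_int_of_den_dvd _ ((Finset.dvd_prod_of_mem _ (Finset.mem_univ i)).mul_right _)
  · obtain ⟨z, hz⟩ := exists_int_of_den_dvd (b j k) (m := (∏ i, (a i k).den) *
      ∏ j ∈ Finset.range (k + 1), (b j k).den)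
      ((Finset.dvd_prod_of_mem _ (Finset.mem_range.mpr (Nat.lt_succ_of_le hjk))).mul_left _)
    refine ⟨((∏ i, (a i j).den) * ∏ j' ∈ Finset.range (j + 1), (b j' j).den : ℕ) * z, ?_⟩
    rw [mul_assoc, hz]
    push_cast
    ring

/-- **The greedy integral sequence** (abstract form of "integrality is free"): in the setting of
`exists_rational_sequence` there are `φ k ∈ N k`, `φ k - u k ∈ V₀`, and positive integers `M k`
such that the rescaled vectors `M k • φ k` have INTEGER masses `L i (M k • φ k)` and INTEGER
pairings `B (M j • φ j) (M k • φ k)` for all `i, j, k`. -/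
theorem exists_integral_sequence {p : ℕ}
    (V₀ : Submodule ℝ V) (B : V →ₗ[ℝ] V →ₗ[ℝ] ℝ) (hB : ∀ x y, B x y = B y x)
    (hpos : ∀ x ∈ V₀, x ≠ 0 → 0 < B x x)
    (hbig : ∀ s : Finset V, ∃ w ∈ V₀, w ∉ Submodule.span ℝ (s : Set V))
    (L : Fin p → V →ₗ[ℝ] ℝ) (hL : ∀ y : Fin p → ℝ, ∃ x ∈ V₀, ∀ i, L i x = y i)
    (u : ℕ → V) (N : ℕ → Set V)
    (hN : ∀ (k : ℕ) (κ : Type) [Fintype κ] (F : κ → V), (∀ a, F a ∈ V₀) →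
      ∃ δ : ℝ, 0 < δ ∧ ∀ t : κ → ℝ, (∀ a, |t a| ≤ δ) → u k + ∑ a, t a • F a ∈ N k) :
    ∃ (φ : ℕ → V) (M : ℕ → ℕ), (∀ k, 0 < M k) ∧ (∀ k, φ k - u k ∈ V₀) ∧ (∀ k, φ k ∈ N k) ∧
      (∀ i k, ∃ z : ℤ, L i ((M k : ℝ) • φ k) = z) ∧
      ∀ j k, ∃ z : ℤ, B ((M j : ℝ) • φ j) ((M k : ℝ) • φ k) = z := by
  obtain ⟨φ, hV₀, hN', hLq, hBq⟩ := exists_rational_sequence V₀ B hB hpos hbig L hL u N hN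
  choose a ha using hLq
  choose b hb using hBq
  obtain ⟨M, hM, hMa, hMb⟩ := exists_nat_rescaling a b
  refine ⟨φ, M, hM, hV₀, hN', fun i k ↦ ?_, fun j k ↦ ?_⟩
  · obtain ⟨z, hz⟩ := hMa i k
    refine ⟨z, ?_⟩
    rw [map_smul, smul_eq_mul, ha i k]
    exact_mod_cast hz
  · rcases le_total j k with hjk | hkj
    · obtain ⟨z, hz⟩ := hMb j k hjk
      refine ⟨z, ?_⟩
      have hz' : (M j : ℝ) * (M k : ℝ) * ((b j k : ℚ) : ℝ) = (z : ℝ) := by exact_mod_cast hz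
      rw [← hz', map_smul, map_smul, LinearMap.smul_apply, smul_eq_mul, smul_eq_mul, hb j k]
      ring
    · obtain ⟨z, hz⟩ := hMb k j hkj
      refine ⟨z, ?_⟩
      have hz' : (M k : ℝ) * (M j : ℝ) * ((b k j : ℚ) : ℝ) = (z : ℝ) := by exact_mod_cast hz
      rw [← hz', map_smul, map_smul, LinearMap.smul_apply, smul_eq_mul, smul_eq_mul, hB, hb k j]
      ring

end IntegralGreedy

end Summit.RiemannHypothesis.RiemannHypothesis.Theorems.MotivicDoor.AWS
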